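import Summits.Ventures.PercRepro.Night2LocalExtraThree

/-!
# PercRepro — the local form at `q = 2` when one element lies outside the plane (night-2, gen 7)

The case (C2) of the paper proof of `ShadowHall M 4 2` (`proofs/NIGHT-2-local.md` §8, corrected in §13): `G` is a
plane (rank-`3` flat) with exactly ONE ground element outside it, and every carrying line `F` of `G` has at least
two elements of `G` outside it.  The fractional matching: every member `B` receives `1/3` from each covering set
`B ∪ {z}` (`z ∈ G ∖ cl B`) and, when `|G ∖ cl B| = 2`, a further `2/9` from the EXTRA set `B ∪ (G ∖ cl B)`.

* row sums: with `m = |G ∖ cl B| ≥ 2` and `|E ∖ cl B| = m + 1`, `(4/3)·m/(m+1) ≤ m/3 + (2/9)·[m = 2]`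
  (`c2_row_ineq`);
* column sums: a shadow set `S` carries `κ/3 + 2λ/9` with `κ` its covering preimages and `λ` the members of which
  it is the extra set; `λ ≥ 1` forces `κ = 0` (`coverPreimages_eq_empty_of_extra`) and `λ ≤ 3`
  (`card_extraPreimages_le_three`), so the load is at most `max (3/3, 6/9) = 1`.

**`localShadowHall_two_of_card_compl_one`**: `LocalShadowHall M 2 G` under these hypotheses.  With
`localShadowHall_of_exists_two` (a carrying line with `|E ∖ F| = 2`) and `localShadowHall_of_thin` (all carrying
lines with `|E ∖ F| ≥ 4`), the only case of the local form at a plane still open in the tree is `|E ∖ G| = 2` with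
a carrying line `F = G ∖ {z}` (case (C1), the line statement).
-/

namespace PercRepro.Shadow

open Finset PerFlat ThmH

variable {α : Type*} [DecidableEq α] {M : Matroid α} [M.Finite]

/-- The row inequality of the (C2) scheme: for `m ≥ 2`,
`(4/3) · m/(m+1) ≤ (1/3) · m + (2/9) · [m = 2]`. -/
theorem c2_row_ineq (m : ℕ) (hm : 2 ≤ m) :
    ((4 : ℚ) / 3) * ((m : ℚ) / ((m : ℚ) + 1)) ≤ (1 / 3 : ℚ) * (m : ℚ) + (2 / 9 : ℚ) * (if m = 2 then 1 else 0) := by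
  have hm1 : (0 : ℚ) < (m : ℚ) + 1 := by positivity
  rcases Nat.lt_or_ge m 3 with h | h
  · have : m = 2 := by omega
    subst this
    norm_num
  · have hm' : (3 : ℚ) ≤ (m : ℚ) := by exact_mod_cast h
    have hne : m ≠ 2 := by omega
    rw [if_neg hne, mul_zero, add_zero, mul_div_assoc', div_le_iff₀ hm1]
    nlinarith

/-! ## The local form at `q = 2` with one element outside the plane -/

/-- **The local form at a plane `G` with exactly one ground element outside it, all of whose carrying lines have at
least two elements of `G` outside them** (case (C2) of the paper proof of the diagonal shadow form at `q = 2`):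
`LocalShadowHall M 2 G`, by the «covering + extra sets» matching with `a = 1/3`, `b = 2/9`. -/
theorem localShadowHall_two_of_card_compl_one {G : Finset α} (hG : G ∈ flatsQ M (2 + 1))
    (hd : (gr M \ G).card = 1)
    (hm : ∀ B ∈ Uq M (2 + 2) 2, clF M B ⊆ G → 2 ≤ (G \ clF M B).card) : LocalShadowHall M 2 G := by
  classical
  apply localShadowHall_of_cover_extra hG (1 / 3) (2 / 9) (by norm_num) (by norm_num)
    (fun _ B => extraSets M G B)
  · intro 𝒜 h𝒜 B hB S hS
    rw [mem_extraSets] at hS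
    rw [hS.2]
    exact extra_mem_shadowAt h𝒜 hG hB (Finset.card_pos.1 (by rw [hS.1]; norm_num))
  · intro 𝒜 h𝒜 B hB
    have hBU : B ∈ Uq M (2 + 2) 2 := h𝒜 (mem_membersIn.1 hB).1
    have hm' := hm B hBU (mem_membersIn.1 hB).2
    unfold localWeight
    rw [card_compl_clF_of_card_compl_one hG hd (mem_membersIn.1 hB).2]
    have hcard : ((extraSets M G B).card : ℚ) = if (G \ clF M B).card = 2 then 1 else 0 := by
      unfold extraSets
      split_ifs <;> simp
    rw [hcard]
    have h := c2_row_ineq (G \ clF M B).card hm'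
    push_cast at h ⊢
    convert h using 2
    norm_num
  · intro 𝒜 h𝒜 S hS
    by_cases hlam : ((membersIn M 𝒜 G).filter (fun B => S ∈ extraSets M G B)).card = 0
    · rw [hlam]
      have hκ := card_coverPreimages_le h𝒜 hS
      have hκ' : ((coverPreimages M 𝒜 G S).card : ℚ) ≤ 3 := by exact_mod_cast hκ
      push_cast
      linarith
    · obtain ⟨B, hB⟩ := Finset.card_pos.1 (Nat.pos_of_ne_zero hlam)
      rw [Finset.mem_filter] at hB
      rw [coverPreimages_eq_empty_of_extra h𝒜 hG hd hB.1 hB.2, Finset.card_empty]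
      have hl := card_extraPreimages_le_three h𝒜 hG hd S
      have hl' : (((membersIn M 𝒜 G).filter (fun B => S ∈ extraSets M G B)).card : ℚ) ≤ 3 := by
        exact_mod_cast hl
      push_cast
      linarith

end PercRepro.Shadow
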